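import Summits.BirchSwinnertonDyer.Rank1Residual.O6.X3WildOfKMCTorsionFreeMember
import Summits.BirchSwinnertonDyer.Rank1Residual.O6.X3KatoMemberBound
import Literature.NumberTheory.EllipticCurves.Kato2004.HullDescentSkeletonProofs
import Literature.NumberTheory.EllipticCurves.ShaIsogenyProofs
import HarnessLib

/-!
# O6 / X3: Kato's MEMBER BOUND `O6.KatoMemberShaBoundOfReducible` (T-X3K; the crux `ReducibleKatoMember`
# of route `KatoDescentPotSupersingular`) PROVED OVER PRINTED READINGS — the Kato descent at Kato's member
# `W_K` WITH rational `p`-torsion, through the REFLEXIVE HULL of `𝐇¹(T)`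
# (cell `bsd-potss`, seat `kmc`, generation 6; part 12 of the descent files; kernel assembly over the
# hull-descent algebra `Literature/…/Kato2004/HullDescentSkeletonProofs.lean`; nothing asserted)

HONEST FRAMING (cell `bsd-potss`, `run/shared/lean/pub/bsd-potss/`, FULL-BSD rank-`≤ 1` programme
tranche 1b, row B5 = O6 wild `3`, X3 half (18 852 S-b pairs), and type-blind the X3 rows of row B4;
typed against cell `b2b-bsdres`'s node `O6.KatoMemberShaBoundOfReducible` of `O6/X3KatoMemberBound.lean`,
which the K9 route file `Theses/KatoDescentPotSupersingular.lean` names as its crux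
`ReducibleKatoMember`): NOTHING about Kato's objects is asserted and no Literature fact is minted. As
in parts 1–10 (`KatoDescentDatum`, `KatoDescentTorsionFreeReadings`, …) Kato's `Λ`-modules enter
through an INTERFACE — here `KatoHullDescentDatum p` + the interface predicate `IsHullOf` (a section
variable: "`D` is Kato's §14.14 data of `T_pW` with the zeta element placed in the reflexive hull",
a D-O6-2-type definition request) — and the printed theorems about them as HYPOTHESIS SCHEMATA with
locators (§2). Census numbers are not inputs; nothing is booked; X3 ∧ O6 stays OPEN; the crux
`ReducibleKatoMember` is NOT closed by this file (it is proved over displayed readings: a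
conditional result, `--supports`).

## The mathematics (memo v5 §2 of `HOME/bsd-potss-kmc/KMC-DESCENT-MEMO-v5.md`; o6-r1 GEN 21 T-X3K)

Let `p ≠ 2` be additive potentially good for `E/ℚ` with `E[p]` REDUCIBLE, `L(E,1) ≠ 0`. Kato's member
`W_K` of the isogeny class is the curve with `T_pW_K ≅ V_{ℤ_p}(f)(1)` (Kato 8.3 / 6.3; Wuthrich 2014
§3.2, p. 394: "it is crucial that we work with exactly the lattice `T = V_{ℤ_p}(f)(1)`"; it exists since
every Galois-stable `ℤ_p`-lattice of `V_pE` is the Tate module of a `ℚ`-isogenous curve, *AEC*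
III.4.12 / Rem. 4.13.2). On the `Δ`-trivial component `Λ = ℤ_p⟦X⟧`: `H = 𝐇¹(T)⁰` is finitely generated
torsion free of rank one (Thm. 12.4 (2)) but NOT free in general when `p ∣ #W_K(ℚ)_tors` (Wuthrich
Lemma 10 and the example 11a, p. 392); let `j : H ↪ F` be its reflexive hull (free of rank one, finite
cokernel — Wuthrich p. 394: "an injective `Λ`-morphism `ι : 𝐇¹(T) → Λ` with finite cokernel"). Kato's
Thm. 12.6 (`Z ⊂ Z(f,T)` of finite index, `Z ⊂ 𝐇¹(T)` integral) puts `z = z_γ⁰` in `F` ("this `J`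
contains the integral ideal `ι(Z)` with finite index. Hence `J` itself is an integral ideal", p. 394;
= Kato 13.14 sentences 1–2 = Wuthrich Lemma 12), and `y := p^e z ∈ H` for `p^e Z(f,T) ⊂ Z`
(Wuthrich Lemma 11: "for any `k ≥ 0` such that `p^k Z_T ⊂ Z`"). DIVISIBILITY FOR THE HULL: at
height-one `𝔮 ∌ p`, `ℓ_𝔮(𝐇²(T)) ≤ ℓ_𝔮(F/Λz)` is Kato's Thm. 12.5 (3) (rational coefficients; the local
term `𝐇²_loc` vanishes at a potentially good `p`, (12.5.1) / Remark 12.7) = Wuthrich Lemma 11 + Thm.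
13.4 (3); at `𝔮 = (p)` it is `μ(𝐇²(T)⁰) = 0`, which for REDUCIBLE `E[p]` is Wuthrich's Lemma 14
("`E` admits an isogeny of degree `p` ⟹ the fine Selmer group `Y(E)` is a finitely generated
`ℤ_p`-module", no reduction hypothesis) read through global duality (`Y(E)` = kernel of
`𝐇²(T) → ⊕_v 𝐇²_v(T)`, Wuthrich p. 396 / Kato 13.x), the local terms being finitely generated over
`ℤ_p` (finitely many places above `ℓ ≠ p` in `ℚ(ζ_{p^∞})`; above `p`, `E(ℚ_p(μ_{p^∞}))[p^∞]` is finite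
for potentially good reduction — Imai). ALGEBRA (tree theorem
`Kato2004.padicValNat_natCard_coinvariants_add_le_of_hull`, part 11): along (14.14.1)
`0 → H/XH → A = H¹(ℤ[1/p],T) → 𝐇²(T)⁰[X] → 0` these give **`e + ord_p #(H2/XH2) ≤ ord_p [A : y]`**,
i.e. Kato's `μ = [A : z]/#H²(ℤ[1/p],T) = [A : y]·p^{−e}/#H² ≥ 1` with NO defect from the hull index.
COUNT (Prop. 14.16 (2), image-free, with BOTH `H⁰` factors `#H⁰(ℚ,T⊗ℚ/ℤ) = #H⁰(ℚ,T*(1)⊗ℚ/ℤ) =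
#W_K(ℚ)[p^∞] = p^t` (`T*(1) ≅ T_pE` by the Weil pairing); §14.8 with Greenberg Prop. 4.13 — Lemma T
INEXACT: `[S(T) : Sel(T)]·#coker = ∏_{ℓ≠p} c_ℓ^{(p)}` with `#coker ∣ #E(ℚ)[p^∞] = p^t`
(Cassels–Poitou–Tate); the local index `exp*_ω H¹(ℚ_p,T) = c_p·p^{−τ}ℤ_p`, `#H²(ℚ_p,T) = p^τ`
(Kim AJM 2026 §3.2.3; `τ` cancels); `exp*(z) = L(E,1)/Ω` (Thm. 12.5 (1), member-free normalisation of
parts 1/8a)): **`ord_p #Ш + v_p(Tam) + ord_p [A : y] ≤ ord_p(L/Ω) + e + ord_p #(H2/XH2) + 3t`**.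
Together: **`ord_p #Ш(W_K)[p^∞] + v_p(Tam W_K) ≤ ord_p (L(W_K,1)/Ω(W_K)) + 3·ord_p #W_K(ℚ)_tors`** —
T-X3K, at the member `W' := W_K`. This is Wuthrich 2014 §3.2–3.4 (semistable `p`, hull `ι : 𝐇¹ → Λ`,
`p^k z`, Lemma 11, Lemma 14, Prop. 15) transplanted to an ADDITIVE potentially good `p` and run at
`X = 0` with Kato's §14.14–14.16 in place of the `p`-adic `L`-function.

## Contents

* §1 the interface `KatoHullDescentDatum p` (Kato's §14.14 data with the zeta element in the hull:
  `j : H ↪ F`, `z ∈ F`, `y ∈ H`, `j y = p^e z`, `H2`, `A`, (14.14.1)), `D.yIndex = [A : y]`,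
  `D.h2Card = #(H2/XH2)`, `D.HullDivisibility`, and the hull descent on the datum
  (`KatoHullDescentDatum.le_padicValNat_yIndex`, from part 11).
* §2 the three READINGS over `IsHullOf` (hypothesis schemata, nothing asserted):
  `KatoHull.MemberRealizable` (Kato's member exists and carries a realised hull datum),
  `KatoHull.DivisibilityReading` (the divisibility for the hull on the reducible rows),
  `KatoHull.CountReading` (the rank-`0` count at a member WITH `p`-torsion — the "t > 0 reading" left
  open in memo v3 §X3.3).
* §3 **`O6.katoMemberShaBoundOfReducible_of_hullReadings`**: the three readings give
  `O6.KatoMemberShaBoundOfReducible` (T-X3K), for EVERY odd additive potentially good `p`; the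
  transport of `Addv ∧ ord_p j ≥ 0`, reducibility, `L(·,1)` and finiteness of `Ш` along `W ∼ W_K` is
  kernel (`Addv.of_isIsogenous_of_padicValRat_j_nonneg`, `X2.red_iff_of_isIsogenous`,
  `entireLFunction_eq_of_isIsogenous'`, `IsIsogenous.shaFinite_iff_shaFinite` — all PROVED in the tree).

WHAT THIS IS NOT. Not a proof of T-X3K: a conditional assembly over three displayed readings (the audit
says `proof.conditional`); not a construction of `𝐇^q(T)`, `z_γ`, the hull or Kato's member (interfaces;
D-O6-2 stands); no claim that `𝐇¹(T)⁰` is free or that `z_γ` is integral at `W_K`; not the LOWER half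
(that is KMC, parts 8–10); nothing at `p = 2` or at a potentially multiplicative `p`; no census number
is an input; nothing is booked.

References: K. Kato, Astérisque 295 (2004): 8.3 (p. 181), Thm. 12.4 (p. 221), Thm. 12.5 (1), (3)
(pp. 221–222), Thm. 12.6 (p. 222), Remark 12.7 (p. 222), Thm. 13.4 (3) (p. 226), 13.14 (p. 234), §14.8
(p. 238), Thm. 14.5 (1)–(2) and the index `[M : z]` (pp. 236–237), §14.14 (14.14.1)–(14.14.2) and
Lemma 14.15 (pp. 243–244), Prop. 14.16 (2) (p. 244) [Kato2004Asterisque]; C. Wuthrich, Doc. Math. 19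
(2014) §3.2 (p. 394), Lemma 10 (p. 392), Lemma 11, Lemma 12 (p. 394–395), Lemma 14 (p. 396), Prop. 15
[Wuthrich2014]; R. Greenberg, LNM 1716 (1999) Prop. 4.13, §3 [GreenbergLNM1716]; C.-H. Kim, AJM 148
(2026) §3.2.3 [Kim2022StructureSelmer]; J. Coates, R. Sujatha, Math. Ann. 331 (2005) Thm. 3.4
[CoatesSujatha2005]; J. H. Silverman, *AEC* III.4.12, Rem. III.4.13.2 [SilvermanAEC2009]; N. Bourbaki,
*AC* VII §4 no. 2 [BourbakiAC5to7].
-/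

set_option autoImplicit false

noncomputable section

open scoped Classical

open WeierstrassCurve Literature.NumberTheory.EllipticCurves
  Literature.NumberTheory.EllipticCurves.ModularForms
  Literature.NumberTheory.EllipticCurves.Rank1Residual
  Literature.NumberTheory.EllipticCurves.Rank1Residual.Typed
  Literature.NumberTheory.EllipticCurves.IwasawaAlgebra

namespace Summit.BirchSwinnertonDyer.Rank1Residual.Additive

/-! ## §1 The interface: Kato's §14.14 data with the zeta element in the reflexive hull -/

/-- **INTERFACE (definition request, D-O6-2 shape): Kato's §14.14 descent data for `(T, p)` on the
`Δ`-trivial component when the zeta element is only known to lie in the REFLEXIVE HULL of `𝐇¹(T)⁰`.**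
`H` = `𝐇¹(T)⁰` (finitely generated torsion free, Thm. 12.4 (2)); `F` = its reflexive hull `(𝐇¹(T)⁰)^{**}`
(free of rank one over the two-dimensional regular local ring `Λ`; abstractly: finitely generated
torsion free) with the inclusion `j : H ↪ F` of FINITE cokernel (Wuthrich 2014 p. 394: "an injective
`Λ`-morphism `ι : 𝐇¹(T) → Λ` with finite cokernel"); `z` = the component of Kato's zeta element `z_γ^{(p)}`,
which lies in `F` by Thm. 12.6 + 13.14 (Wuthrich p. 394 / Lemma 12), `z ≠ 0` with `F/Λz` torsion
(rank one, Thm. 12.4 (2), 12.5 (2)); `y ∈ H` and `e` with `j y = p^e z` (Kato p. 236 "`z = c⁻¹y`";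
Wuthrich Lemma 11 "`p^k Z_T ⊂ Z`", from the finite index of Thm. 12.6); `H2` = `𝐇²(T)⁰` (finitely
generated torsion, Thm. 12.4 (1)); `A` = `H¹(ℤ[1/p], j_*T)` with (14.14.1) `0 → H/XH →ι A →π H2[X] → 0`
(image-free: the long exact sequence of `0 → T⊗Λ^ι →^{X} T⊗Λ^ι → T → 0`, `cd_p = 2`). The structure only
NAMES modules and maps; "`D` IS Kato's hull datum for `(T_pW)⁰`" is the interface predicate `IsHullOf`
(a section variable below), never a hypothesis smuggled into a certificate.
[cite: Kato2004Asterisque, Thm. 12.4 (p. 221), Thm. 12.6 (p. 222), 13.14 (p. 234), `[M : z]` (pp. 236–237), §14.14 (14.14.1) (p. 243)]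
[cite: Wuthrich2014, §3.2 (p. 394), Lemma 11 and Lemma 12 (pp. 394–395)] -/
structure KatoHullDescentDatum (p : ℕ) [Fact p.Prime] : Type 1 where
  /-- `𝐇¹(T)⁰`. -/
  H : Type
  [acgH : AddCommGroup H]
  [modH : Module (IwasawaAlgebra p) H]
  [finH : Module.Finite (IwasawaAlgebra p) H]
  [tfH : NoZeroSMulDivisors (IwasawaAlgebra p) H]
  /-- the reflexive hull `(𝐇¹(T)⁰)^{**}`. -/
  F : Type
  [acgF : AddCommGroup F]
  [modF : Module (IwasawaAlgebra p) F]
  [finF : Module.Finite (IwasawaAlgebra p) F]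
  [tfF : NoZeroSMulDivisors (IwasawaAlgebra p) F]
  /-- the inclusion `𝐇¹(T)⁰ ↪ (𝐇¹(T)⁰)^{**}`. -/
  j : H →ₗ[IwasawaAlgebra p] F
  j_injective : Function.Injective j
  /-- the hull has finite (pseudo-null) cokernel. -/
  finite_coker : Finite (F ⧸ LinearMap.range j)
  /-- the zeta element `(z_γ^{(p)})⁰`, in the hull. -/
  z : F
  z_ne_zero : z ≠ 0
  /-- `F/Λz` is torsion (`𝐇¹` has rank one). -/
  isTorsion_quotient : Module.IsTorsion (IwasawaAlgebra p) (F ⧸ (IwasawaAlgebra p) ∙ z)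
  /-- an integral multiple `y = p^e z ∈ 𝐇¹(T)⁰` (Kato's `z = c⁻¹ y`). -/
  y : H
  /-- the exponent with `j y = p^e z`. -/
  e : ℕ
  j_y : j y = PowerSeries.C ((p : ℤ_[p]) ^ e) • z
  /-- `𝐇²(T)⁰`. -/
  H2 : Type
  [acgH2 : AddCommGroup H2]
  [modH2 : Module (IwasawaAlgebra p) H2]
  [finH2 : Module.Finite (IwasawaAlgebra p) H2]
  isTorsion_H2 : Module.IsTorsion (IwasawaAlgebra p) H2
  /-- `H¹(ℤ[1/p], j_*T)`. -/
  A : Type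
  [acgA : AddCommGroup A]
  [modA : Module (IwasawaAlgebra p) A]
  /-- (14.14.1), first map. -/
  ι : coinvariants p H →ₗ[IwasawaAlgebra p] A
  /-- (14.14.1), second map. -/
  π : A →ₗ[IwasawaAlgebra p] invariants p H2
  ι_injective : Function.Injective ι
  π_surjective : Function.Surjective π
  exact_ι_π : Function.Exact ι π

namespace KatoHullDescentDatum

variable {p : ℕ} [Fact p.Prime] (D : KatoHullDescentDatum p)

/-- The bundled abelian-group structure of `D.H`. [folklore] -/
instance instAddCommGroupH : AddCommGroup D.H := D.acgH
/-- The bundled `Λ`-module structure of `D.H`. [folklore] -/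
instance instModuleH : Module (IwasawaAlgebra p) D.H := D.modH
/-- `D.H` is finitely generated (bundled). [folklore] -/
instance instFiniteH : Module.Finite (IwasawaAlgebra p) D.H := D.finH
/-- `D.H` is torsion free (bundled). [folklore] -/
instance instNoZeroSMulDivisorsH : NoZeroSMulDivisors (IwasawaAlgebra p) D.H := D.tfH
/-- The bundled abelian-group structure of `D.F`. [folklore] -/
instance instAddCommGroupF : AddCommGroup D.F := D.acgF
/-- The bundled `Λ`-module structure of `D.F`. [folklore] -/
instance instModuleF : Module (IwasawaAlgebra p) D.F := D.modF
/-- `D.F` is finitely generated (bundled). [folklore] -/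
instance instFiniteF : Module.Finite (IwasawaAlgebra p) D.F := D.finF
/-- `D.F` is torsion free (bundled). [folklore] -/
instance instNoZeroSMulDivisorsF : NoZeroSMulDivisors (IwasawaAlgebra p) D.F := D.tfF
/-- The bundled abelian-group structure of `D.H2`. [folklore] -/
instance instAddCommGroupH2 : AddCommGroup D.H2 := D.acgH2
/-- The bundled `Λ`-module structure of `D.H2`. [folklore] -/
instance instModuleH2 : Module (IwasawaAlgebra p) D.H2 := D.modH2
/-- `D.H2` is finitely generated (bundled). [folklore] -/
instance instFiniteH2 : Module.Finite (IwasawaAlgebra p) D.H2 := D.finH2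
/-- The bundled abelian-group structure of `D.A`. [folklore] -/
instance instAddCommGroupA : AddCommGroup D.A := D.acgA
/-- The bundled `Λ`-module structure of `D.A`. [folklore] -/
instance instModuleA : Module (IwasawaAlgebra p) D.A := D.modA

/-- **Kato's index `[H¹(ℤ[1/p],T) : y] = [A : Λ·ι(ȳ)]` of the INTEGRAL multiple `y = p^e z`** (p. 236:
`[M : z] = [M : O_L y]·[O_L : c O_L]⁻¹` with `c = p^e`). [cite: Kato2004Asterisque, Thm. 14.5 and the definition of `[M : z]` (pp. 236–237)] -/
def yIndex : ℕ :=
  Nat.card (D.A ⧸ (IwasawaAlgebra p) ∙ D.ι (Submodule.Quotient.mk D.y))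

/-- **`#H²(ℤ[1/p],T) = #(𝐇²(T)/X𝐇²(T))`** ((14.14.2)), as `#(H2/XH2)`.
[cite: Kato2004Asterisque, §14.14 (14.14.2) (p. 243)] -/
def h2Card : ℕ :=
  Nat.card (coinvariants p D.H2)

/-- **The divisibility for the HULL**: `ℓ_𝔮(𝐇²(T)⁰) ≤ ℓ_𝔮(F/Λz)` at every height-one prime `𝔮` of `Λ`
(off `(p)`: Thm. 12.5 (3) with `𝐇²_loc = 0` at a potentially good `p`; at `(p)`: `μ(𝐇²(T)⁰) = 0`).
[cite: Kato2004Asterisque, Thm. 12.5 (3) and Remark 12.7 (p. 222)] [cite: Wuthrich2014, Lemma 11 (p. 394), Lemma 14 (p. 396)] -/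
def HullDivisibility : Prop :=
  ∀ 𝔮 : PrimeSpectrum (IwasawaAlgebra p), 𝔮.asIdeal.height = 1 →
    Module.lengthAt (IwasawaAlgebra p) D.H2 𝔮 ≤
      Module.lengthAt (IwasawaAlgebra p) (D.F ⧸ (IwasawaAlgebra p) ∙ D.z) 𝔮

/-- **The hull descent on the datum (part 11, `Kato2004.padicValNat_natCard_coinvariants_add_le_of_hull`):
`e + ord_p #(H2/XH2) ≤ ord_p [A : y]`**, i.e. Kato's `μ = [A : y]·p^{−e}/#H²(ℤ[1/p],T) ≥ 1`, from the
divisibility for the hull, `H2/XH2` finite and `[A : y] ≠ 0` — with no defect from the hull index.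
[cite: Kato2004Asterisque, §14.14 and Lemma 14.15 (pp. 243–244), Thm. 14.5 (3) (p. 236)] -/
theorem le_padicValNat_yIndex (hdiv : D.HullDivisibility) (hfin : Finite (coinvariants p D.H2))
    (hne : D.yIndex ≠ 0) : D.e + padicValNat p D.h2Card ≤ padicValNat p D.yIndex :=
  Kato2004.padicValNat_natCard_coinvariants_add_le_of_hull D.j D.j_injective D.finite_coker D.z
    D.z_ne_zero D.isTorsion_quotient D.isTorsion_H2 hdiv D.y D.e D.j_y D.ι D.π D.ι_injective
    D.π_surjective D.exact_ι_π hfin hne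

end KatoHullDescentDatum

/-! ## §2 The readings (hypothesis schemata over the interface predicate; nothing asserted) -/

namespace KatoHull

section Readings

variable (IsHullOf : ∀ (W : WeierstrassCurve ℚ) [W.IsElliptic] [W.IsGloballyMinimal] (p : ℕ)
  [Fact p.Prime], KatoHullDescentDatum p → Prop)

/-- **READING M1 — Kato's member exists and carries a realised hull datum.** For `W/ℚ` globally minimal,
`p ≠ 2` additive potentially good with `W[p]` REDUCIBLE: there is a globally minimal `W_K`, `ℚ`-isogenous
to `W`, with `T_pW_K ≅ V_{ℤ_p}(f)(1)` as Galois lattices (Kato 8.3 with the integral structure of 6.3;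
Wuthrich 2014 §3.2 p. 394; such a curve exists because a Galois-stable `ℤ_p`-lattice of `V_pE`
between `p^nT_pE` and `T_pE` is the Tate module of the `ℚ`-isogenous quotient by the corresponding
finite subgroup — *AEC* III.4.12 / Rem. III.4.13.2), and for it Kato's §14.14 data with the zeta element
in the hull (Thm. 12.4, Thm. 12.6 + 13.14, (14.14.1) by the argument of 13.8) form a
`KatoHullDescentDatum p` of `W_K`. Hypothesis schema; nothing asserted.
[cite: Kato2004Asterisque, 8.3 (p. 181), Thm. 12.4 (p. 221), Thm. 12.6 (p. 222), 13.14 (p. 234), §14.14 (p. 243)]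
[cite: Wuthrich2014, §3.2 (p. 394), Lemma 11 and Lemma 12 (pp. 394–395)]
[cite: SilvermanAEC2009, Prop. III.4.12 and Remark III.4.13.2] -/
def MemberRealizable : Prop :=
  ∀ (W : WeierstrassCurve ℚ) [W.IsElliptic] [W.IsGloballyMinimal] (p : ℕ) [Fact p.Prime],
    p ≠ 2 → Addv W p → 0 ≤ padicValRat p W.j → ¬ W.HasIrreducibleModPGaloisRep p →
    ∃ (W' : WeierstrassCurve ℚ) (_ : W'.IsElliptic) (_ : W'.IsGloballyMinimal),
      IsIsogenous W W' ∧ ∃ D : KatoHullDescentDatum p, IsHullOf W' p D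

/-- **READING M2 — the divisibility for the hull on the REDUCIBLE rows.** For a realised hull datum of a
globally minimal `W` at `p ≠ 2` additive potentially good with `W[p]` reducible,
`ℓ_𝔮(𝐇²(T)⁰) ≤ ℓ_𝔮(F/Λz)` at EVERY height-one prime `𝔮`: for `𝔮 ∌ p` this is Kato's Thm. 12.5 (3)
(rational coefficients, `F_𝔮 = 𝐇¹(V)⁰_𝔮`, `Z(f)⁰_𝔮 = Λ_𝔮 z`; the local term `𝐇²_loc(V)_𝔮` vanishes
since (12.5.1) fails at a potentially good `p`, Remark 12.7) — equivalently Wuthrich's Lemma 11 with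
Thm. 13.4 (3); for `𝔮 = (p)` it is `μ(𝐇²(T)⁰) = 0`, which holds because `W[p]` is reducible: Wuthrich's
Lemma 14 ("`E` admits an isogeny of degree `p` ⟹ the fine Selmer group `Y(E)` is a finitely generated
`ℤ_p`-module", no hypothesis on the reduction; Coates–Sujatha Thm. 3.4) and global duality (`Y(E)` is
the kernel of `𝐇²(T) → ⊕_v 𝐇²_v(T)`, whose local terms are finitely generated over `ℤ_p`: finitely
many places of `ℚ(ζ_{p^∞})` above each `ℓ ≠ p`, and `E(ℚ_p(μ_{p^∞}))[p^∞]` finite at a potentially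
good `p`). Hypothesis schema; nothing asserted.
[cite: Kato2004Asterisque, Thm. 12.5 (3) and Remark 12.7 (p. 222), Thm. 13.4 (3) (p. 226)]
[cite: Wuthrich2014, Lemma 11 (p. 394), Lemma 14 and proof of Prop. 15 (p. 396)]
[cite: CoatesSujatha2005, Thm. 3.4] -/
def DivisibilityReading : Prop :=
  ∀ (W : WeierstrassCurve ℚ) [W.IsElliptic] [W.IsGloballyMinimal] (p : ℕ) [Fact p.Prime]
    (D : KatoHullDescentDatum p),
    p ≠ 2 → Addv W p → 0 ≤ padicValRat p W.j → ¬ W.HasIrreducibleModPGaloisRep p →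
    IsHullOf W p D → D.HullDivisibility

/-- **READING M3 — the rank-`0` count at a member WITH rational `p`-torsion (the "`t > 0` reading").**
For `W/ℚ` globally minimal, `p ≠ 2` additive potentially good, `L(E,1) ≠ 0`, `Ш(E)` finite and a realised
hull datum `D` of `W`, with `p^t = #W(ℚ)[p^∞]` and `L(E,1)/Ω(W) = q ∈ ℚ`: `H²(ℤ[1/p],T)` is finite
(Thm. 14.5 (1)) and `[A : y]` is finite (`y = p^e z` is non-torsion in the rank-one `A`: Thm. 14.5
(1)–(2)), and
**`ord_p #Ш(E)(p) + v_p(Tam E) + ord_p [A : y] ≤ ord_p q + e + ord_p #H²(ℤ[1/p],T) + 3t`** —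
Prop. 14.16 (2) `#S(T) = μ⁻¹ ν #H⁰(ℚ,T⊗ℚ/ℤ) #H⁰(ℚ,T*(1)⊗ℚ/ℤ)` (any stable lattice; both `H⁰` have
order `p^t`, `T*(1) ≅ T_pE` by the Weil pairing) with `μ = [A : y]·p^{−e}·#H²(ℤ[1/p],T)⁻¹` (Kato's
`[A : z]` for `z = p^{−e}y`), `ν = p^{ord_p q − v_p(c_p)}` (`exp*_ω H¹(ℚ_p,T) = c_p·p^{−τ}ℤ_p` and
`#H²(ℚ_p,T) = p^τ`, Kim §3.2.3; `exp*(z) = L(E,1)/Ω`, Thm. 12.5 (1) in the member-free normalisation of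
parts 1/8a), `#Ш[p^∞] = #Sel(T) ≤ #S(T)` in rank `0` (§14.1, §14.8) sharpened by Lemma T:
`[S(T) : Sel(T)]·#coker = ∏_{ℓ≠p} c_ℓ^{(p)}` with `#coker ∣ #E(ℚ)[p^∞] = p^t` (Greenberg Prop. 4.13 /
Cassels–Poitou–Tate). = part 8a's `TorsionFree.DescentCountReading` with `p ∤ #tors` REMOVED (three
slack terms `t`) and the zeta element replaced by its integral multiple `y`. Hypothesis schema; nothing
asserted.
[cite: Kato2004Asterisque, Thm. 14.5 (1)–(2) (p. 236), Prop. 14.16 (2) and proof (pp. 244–245), §14.8 (p. 238), §14.1 (pp. 234–235), Thm. 12.5 (1) (p. 221)]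
[cite: GreenbergLNM1716, Prop. 4.13 and §3 after Lemma 3.3] [cite: Kim2022StructureSelmer, §3.2.3 display before Thm. 3.7 (PDF p. 16)] -/
def CountReading : Prop :=
  ∀ (W : WeierstrassCurve ℚ) [W.IsElliptic] [W.IsGloballyMinimal] (p : ℕ) [Fact p.Prime]
    (D : KatoHullDescentDatum p),
    p ≠ 2 → Addv W p → 0 ≤ padicValRat p W.j →
    W.entireLFunction 1 ≠ 0 → Finite W.sha → IsHullOf W p D →
    Finite (coinvariants p D.H2) ∧ D.yIndex ≠ 0 ∧
      ∃ q : ℚ, W.entireLFunction 1 / (W.realPeriodRat : ℂ) = (q : ℂ) ∧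
        (padicValNat p (Nat.card (AddCommGroup.primaryComponent W.sha p)) : ℤ) +
            padicValNat p W.tamagawaProduct + padicValNat p D.yIndex ≤
          padicValRat p q + D.e + padicValNat p D.h2Card + 3 * (padicValNat p W.torsionOrder : ℤ)

end Readings

end KatoHull

end Summit.BirchSwinnertonDyer.Rank1Residual.Additive

/-! ## §3 The member bound T-X3K from the readings -/

namespace Summit.BirchSwinnertonDyer.Rank1Residual

open Additive

variable {IsHullOf : ∀ (W : WeierstrassCurve ℚ) [W.IsElliptic] [W.IsGloballyMinimal] (p : ℕ)
  [Fact p.Prime], KatoHullDescentDatum p → Prop}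

/-- **T-X3K OVER THE READINGS — Kato's member bound `O6.KatoMemberShaBoundOfReducible` (the crux
`ReducibleKatoMember` of route `KatoDescentPotSupersingular`) follows from the three hull readings**, at
EVERY odd additive potentially good prime `p` with `E[p]` reducible: take Kato's member `W' := W_K`
(Reading M1); `Addv ∧ ord_p j ≥ 0`, reducibility, `L(·,1) ≠ 0` and the finiteness of `Ш` pass from `W`
to `W_K` along the isogeny (tree theorems `Addv.of_isIsogenous_of_padicValRat_j_nonneg`,
`X2.red_iff_of_isIsogenous`, `entireLFunction_eq_of_isIsogenous'`, `IsIsogenous.shaFinite_iff_shaFinite`);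
the count (Reading M3) and the hull descent `e + ord_p #H² ≤ ord_p [A : y]` (part 11, from the
divisibility Reading M2) give `ord_p #Ш(W_K)[p^∞] + v_p(Tam W_K) ≤ ord_p(L(W_K,1)/Ω(W_K)) +
3·ord_p #W_K(ℚ)_tors`. Conditional assembly over displayed readings; nothing about Kato's objects is
asserted; the crux is NOT closed by this theorem.
[cite: Kato2004Asterisque, Thm. 12.6 (p. 222), §14.14 and Lemma 14.15 (pp. 243–244), Prop. 14.16 (2) (p. 244)]
[cite: Wuthrich2014, Lemma 11, Lemma 12 (pp. 394–395), Lemma 14 (p. 396)] -/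
theorem O6.katoMemberShaBoundOfReducible_of_hullReadings
    (hM : KatoHull.MemberRealizable IsHullOf) (hD : KatoHull.DivisibilityReading IsHullOf)
    (hC : KatoHull.CountReading IsHullOf) : O6.KatoMemberShaBoundOfReducible := by
  intro W _ _ p _ hp hng hnm hj hred hL hfin
  obtain ⟨W', hE', hM', hiso, D, hDof⟩ := hM W p hp ⟨hng, hnm⟩ hj hred
  -- transport the hypotheses to Kato's member `W'`
  obtain ⟨hadd', hj'⟩ := Addv.of_isIsogenous_of_padicValRat_j_nonneg (p := p) ⟨hng, hnm⟩ hj hiso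
  have hred' : ¬ W'.HasIrreducibleModPGaloisRep p :=
    (X2.red_iff_of_isIsogenous (p := p) hiso).mp hred
  have hL' : W'.entireLFunction 1 ≠ 0 := by
    rwa [← entireLFunction_eq_of_isIsogenous' hiso]
  have hfin' : Finite W'.sha := (IsIsogenous.shaFinite_iff_shaFinite hiso).mp hfin
  -- the count, the divisibility, the hull descent
  obtain ⟨hfin2, hne, q, hq, hcount⟩ := hC W' p D hp hadd' hj' hL' hfin' hDof
  have hdiv : D.HullDivisibility := hD W' p D hp hadd' hj' hred' hDof
  have hhull : D.e + padicValNat p D.h2Card ≤ padicValNat p D.yIndex :=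
    D.le_padicValNat_yIndex hdiv hfin2 hne
  refine ⟨W', hE', hM', hiso, hfin', q, hq, ?_⟩
  have hhull' : (D.e : ℤ) + (padicValNat p D.h2Card : ℤ) ≤ (padicValNat p D.yIndex : ℤ) := by
    exact_mod_cast hhull
  linarith

end Summit.BirchSwinnertonDyer.Rank1Residual

end
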